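import Literature.Probability.Percolation.QuadLowestCrossingDefs
import Literature.Probability.Percolation.QuadCrossingNullFrontier
import HarnessLib

/-!
# A chart crossing pushes forward to a Schramm–Smirnov crossing of the chart quad

Topic `Probability/Percolation`; proofs only, next to `QuadLowestCrossingDefs.lean`
(`SSContinuity.ChartCrossed G a b c d δ ω`: a continuum of the chart rectangle `[a,b] × [c,d]`,
drawn by `G` into the open edges of `ω` at mesh `δ`, meeting both vertical sides) and
`QuadCrossingNullFrontier.lean` (`Quad.rectMap a b`, the affine chart of `[0,1]²` onto
`[-a,a] × [-b,b]`, and the quad `Quad.rectQuad H a b = H ∘ rectMap a b`).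

* `isCrossing_rectQuad_of_chartCrossed` — a `ChartCrossed H (-a) a c d δ ω` witness whose vertical
  extent `[c,d]` lies in `[-b,b]` pushes forward by `H` to a crossing (Schramm–Smirnov, §1.3: "a
  connected compact subset of `[Q]` that intersects both opposite sides `∂₀Q` and `∂₂Q`") of the
  quad `rectQuad H a b` lying inside the drawn open edges `openEdgeUnion δ ω`: its points on
  `re = -a`, `re = a` are chart points `rectMap a b (0,t)`, `rectMap a b (1,t)` of the sides `∂₀`,
  `∂₂`.  This is the reading of "`Q` is crossed by `ω`" through a chart used throughout the proof
  of Lemma 5.1 (the perturbed quads `Q^q = H ∘ rectMap`).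

Pure topology; no named fact is introduced or used.

## References

* O. Schramm, S. Smirnov, *On the scaling limits of planar percolation*, Ann. Probab. 39 (2011)
  1768–1814, arXiv:1101.5820, §1.3 (quads, sides, crossings) and proof of Lemma 5.1.
  [SchrammSmirnov2011]
-/

noncomputable section

open scoped unitInterval
open Set Complex

namespace Literature.Probability.Percolation

namespace SSContinuity

open QuadCrossing QuadCrossing.Quad
open Literature.Probability.LatticeModels

/-- A point of the closed rectangle `[-a,a] × [-b,b]` (`a, b > 0`) is the chart point
`rectMap a b p` of the explicit parameter `p = ((re z / a + 1)/2, (im z / b + 1)/2)`; the first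
coordinate is recorded for reading off the sides `re z = ∓a`. [folklore] -/
theorem exists_rectMap_eq_of_mem {a b : ℝ} (ha : 0 < a) (hb : 0 < b) {z : ℂ}
    (hz : z ∈ Icc (-a) a ×ℂ Icc (-b) b) :
    ∃ p : I × I, rectMap a b p = z ∧ ((p.1 : ℝ) = (z.re / a + 1) / 2) := by
  rw [mem_reProdIm] at hz
  obtain ⟨⟨h1, h2⟩, h3, h4⟩ := hz
  refine ⟨(⟨(z.re / a + 1) / 2, ?_⟩, ⟨(z.im / b + 1) / 2, ?_⟩), ?_, rfl⟩
  · constructor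
    · have : -1 ≤ z.re / a := by rw [le_div_iff₀ ha]; linarith
      linarith
    · have : z.re / a ≤ 1 := by rw [div_le_iff₀ ha]; linarith
      linarith
  · constructor
    · have : -1 ≤ z.im / b := by rw [le_div_iff₀ hb]; linarith
      linarith
    · have : z.im / b ≤ 1 := by rw [div_le_iff₀ hb]; linarith
      linarith
  · apply Complex.ext
    · rw [(rectMap_re_im a b _).1]; simp only []; field_simp; ring
    · rw [(rectMap_re_im a b _).2]; simp only []; field_simp; ring

/-- **A chart crossing is a crossing of the chart quad.**  If the chart rectangle
`[-a,a] × [c,d]` with `[c,d] ⊆ [-b,b]` is crossed through `H` (`ChartCrossed H (-a) a c d δ ω`: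
a continuum `K̃` of it, drawn by `H` into the open edges, meeting `re = -a` and `re = a`), then
`H '' K̃` is a crossing of the quad `rectQuad H a b = H ∘ rectMap a b` in the sense of
Schramm–Smirnov (compact, connected, inside `[Q]`, meeting `∂₀Q` and `∂₂Q`) contained in
`openEdgeUnion δ ω`. [cite: SchrammSmirnov2011, §1.3] -/
theorem isCrossing_rectQuad_of_chartCrossed :
    ∀ {D : Set ℂ} (H : ℂ ≃ₜ ℂ) (a b : ℝ) (ha : 0 < a) (hb : 0 < b)
      (hD : ∀ p : unitInterval × unitInterval, H (rectMap a b p) ∈ D)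
      (c d δ : ℝ) (ω : BondConfig (Site 2)), -b ≤ c → d ≤ b →
      ChartCrossed H (-a) a c d δ ω →
        ∃ K : Set ℂ, (rectQuad H a b ha hb hD).IsCrossing K ∧ K ⊆ openEdgeUnion δ ω := by
  intro D H a b ha hb hD c d δ ω hbc hdb hcr
  obtain ⟨K, hKR, hKc, hKconn, hKopen, ⟨u₀, hu₀, hu₀re⟩, ⟨u₂, hu₂, hu₂re⟩⟩ := hcr
  -- the witness sits in the full chart rectangle `[-a,a] × [-b,b]`
  have hKR' : K ⊆ Icc (-a) a ×ℂ Icc (-b) b := fun u hu => by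
    have h := hKR hu
    rw [mem_reProdIm] at h ⊢
    exact ⟨h.1, hbc.trans h.2.1, h.2.2.trans hdb⟩
  refine ⟨H '' K, ⟨hKc.image H.continuous, hKconn.image H H.continuous.continuousOn, ?_, ?_, ?_⟩,
    ?_⟩
  · -- `H '' K ⊆ [Q] = range (H ∘ rectMap a b)`
    rintro _ ⟨u, hu, rfl⟩
    obtain ⟨p, hp, -⟩ := exists_rectMap_eq_of_mem ha hb (hKR' hu)
    exact ⟨p, by rw [rectQuad_apply, hp]⟩
  · -- the point on `re = -a` is on `∂₀Q`
    obtain ⟨p, hp, hp1⟩ := exists_rectMap_eq_of_mem ha hb (hKR' hu₀)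
    refine ⟨H u₀, mem_image_of_mem H hu₀, ⟨p, ?_, by rw [rectQuad_apply, hp]⟩⟩
    show p.1 = 0
    apply Subtype.ext
    rw [hp1, hu₀re, Set.Icc.coe_zero, neg_div, div_self ha.ne']
    ring
  · -- the point on `re = a` is on `∂₂Q`
    obtain ⟨p, hp, hp1⟩ := exists_rectMap_eq_of_mem ha hb (hKR' hu₂)
    refine ⟨H u₂, mem_image_of_mem H hu₂, ⟨p, ?_, by rw [rectQuad_apply, hp]⟩⟩
    show p.1 = 1
    apply Subtype.ext
    rw [hp1, hu₂re, Set.Icc.coe_one, div_self ha.ne']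
    ring
  · -- inside the drawn open edges
    rintro _ ⟨u, hu, rfl⟩
    exact hKopen u hu

end SSContinuity

end Literature.Probability.Percolation

end
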